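import Summits.HodgeConjecture.HodgeConjecture.Theorems.K2LiuNonsplitSliceInert              -- ★ (K2Liu-p04 g3): the inert transport template; `cme_coe_toMulEquiv`, `cme_toMulEquiv_symm_apply`; brings ★ (NS-i), ★ p05 numerics
import Summits.HodgeConjecture.HodgeConjecture.Theorems.K2LiuCartanVolumeDatumAnyPlace       -- ★ (F4a, this seat): `exists_cartanVolumeDatum_anyPlace`
import Summits.HodgeConjecture.HodgeConjecture.Theorems.K2LiuCartanDecayFrame               -- ★ (F3, this seat): `exists_decay_cartan_frame`
import Summits.HodgeConjecture.HodgeConjecture.Theorems.K2LiuDoublingHeightSliceQuasiInvariance  -- ★ (A1) (K2Liu-p05): `exists_placeSlice_quasiBiInvariant`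
import Literature.NumberTheory.Automorphic.AdelicVectorHeightGalois                          -- ★ `norm_galAdicCompletionMap`

/-!
# The finite slice of #32dR at an ISOTROPIC NON-SPLIT `v ∈ S` — ANY ramification, ANY residue characteristic, ANY (rational) hyperbolic frame

Track B ∕ K2-LIT, hLiu418 = stmt-HodgeConjecture-24832; socket #32dR `sig_K2LiuDoublingHeightDecayLocalR2` (U5d ED. 5 :554) through ★
`K2LiuDoublingHeightDecayLocalR2OfNonsplitData.doublingHeightDecayLocalR2_of_nonsplitData` (K2Liu-p04 g3, p857289): at a non-split `v ∈ S` the closer wants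
`IsCompact univ ∨ ‹rank-one Cartan decay datum›`.  LEAD F0P6-plan (g11) deal (26-r) → K2Liu-p04 (g4); REPORT-FIRST
`K2/K2Liu-p04/g4/REPORT-FIRST-26r-IsotropicAnyPlace.K2Liup04g4.md` (F4).  THIS FILE supplies the datum — hence the slice itself — at EVERY non-split place `v`
(inert or ramified, dyadic or not) where the place form of `diag dV` is ISOTROPIC, i.e. admits a RATIONAL hyperbolic frame `T ∈ GL₂(L_w)` (`diag(dV)_w =
σ_w(T)ᵀ·antidiag(1,1)·T`; no integrality, no unimodularity, no `σ`-fixed uniformiser):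
**`exists_rankOneDatum_isotropic`** — the datum in the exact `∃ K₀ tv C₁ Q C₂ r, …` shape of the closer's `_hns`, with `Q = q_w = #𝓀[L_w]`, `r = √‖ϖ‖_w`
(`r^τ·Q < 1 ⟺ τ > 2` at inert AND ramified places, ★ p05 `rpow_norm_uniformizer_mul_pow_lt_one`), and **`integrable_placeSlice_isotropic`** — for `2·2 − 2 < τ`
the slice `u ↦ Φ(ι(ιA placesEmbed_S(1, u at v), 1))^τ` is integrable on `U(H)(L⁺_v)`.  This SUBSUMES ★ `K2LiuNonsplitSliceInert` (unramified hyperbolic lattice).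
ASSEMBLY (the transport of ★ `exists_rankOneDatum_inert`, verbatim, along `κ_v = localCongr g⁻¹ … v`, ★ D5): the volume datum ★ (F4a) `exists_cartanVolumeDatum_anyPlace`
on `U(diag dV)(L⁺_v)` for the Haar measure `ν ∘ κ_v⁻¹`; the decay ★ (F3) `exists_decay_cartan_frame` along the σ_w-fixed ray `c_i` (`(c_i)_w = T⁻¹·diag(π^i, π^{−i})·T`,
`π = ϖσϖ`, `√‖π^i‖ = ‖ϖ‖^i = r^{2i}`, ★ `norm_galAdicCompletionMap`), read in the `H`-frame through ★ p05 `iotaLeft_iotaA_placesEmbed_mulSingle`, and spread to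
`tv(2i) = c_i·z^i`, `tv(2i+1) = tv 1·c_i·z^i` by ★ (A1) quasi-bi-invariance under the compact sets `{1, tv 1}` and `K₀` (`C₂ = c·C∕r`).
Theorems only; no `sorry`; default heartbeats.  [GelbartPiatetskishapiroRallis1987, Part A §6]; [Li1992, §3 Thm. 3.1]; [Liu2011, §2C p. 863]; [BruhatTits1972, (4.4.3)].
HONEST LABEL: HC_CM is proved only modulo the 7 printed citations (2 remaining named inputs: hLiu418 = stmt-HodgeConjecture-24832, h413 =
stmt-HodgeConjecture-24833) until rung 0 closes; count-neutral helper toward #32dR (organ (26-r), every isotropic non-split place), retires nothing by itself.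
-/

set_option autoImplicit false
-- the mandated namespace repeats the single-problem summit's segment (`HodgeConjecture.HodgeConjecture`)
set_option linter.dupNamespace false

noncomputable section

open scoped Matrix ENNReal Valued
open NumberField IsDedekindDomain MeasureTheory

namespace Summit.HodgeConjecture.HodgeConjecture.Cruxes.HLiu418.K2LiuNonsplitSliceIsotropic

open Literature.NumberTheory.Automorphic Literature.NumberTheory.Automorphic.UnitaryGroup
open Literature.NumberTheory.GelbartRogawski1991 Literature.NumberTheory.GelbartRogawski1991.GRConstruction
open Literature.NumberTheory.K2Lit.SiegelDoubled Literature.NumberTheory.K2Lit.PlaceSplitting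
open Summit.HodgeConjecture.HodgeConjecture.Cruxes.HLiu418.K2LiuNonsplitSliceOfRankOneDecay
open Summit.HodgeConjecture.HodgeConjecture.Cruxes.HLiu418.K2LiuNonsplitSliceInert
open Summit.HodgeConjecture.HodgeConjecture.Cruxes.HLiu418.K2LiuCartanVolumeDatumAnyPlace
open Summit.HodgeConjecture.HodgeConjecture.Cruxes.HLiu418.K2LiuCartanDecayFrame
open Summit.HodgeConjecture.HodgeConjecture.Cruxes.HLiu418.K2LiuSplitSliceIntegrable
open Summit.HodgeConjecture.HodgeConjecture.Cruxes.HLiu418.K2LiuSplitCosetCount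
open Summit.HodgeConjecture.HodgeConjecture.Cruxes.HLiu418.K2LiuDoublingHeightSliceQuasiInvariance
open Summit.HodgeConjecture.HodgeConjecture.Cruxes.HLiu418.K2LiuDoublingHeckeCartanSum
open Summit.HodgeConjecture.HodgeConjecture.Cruxes.HLiu418.K2LiuDoublingSliceLocalBridge
open Summit.HodgeConjecture.HodgeConjecture.Cruxes.HLiu418.K2LiuDoublingUnfoldBridge
open Summit.HodgeConjecture.HodgeConjecture.Cruxes.HLiu418.K2LiuSplitSliceOfTorusDecay

variable (L : Type) [Field L] [NumberField L] [IsCMField L]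
variable {n : ℕ} (e : Fin 2 × Fin 1 ≃ Fin n)
  (dV : Fin 2 → L) (hdV : ∀ i, IsCMField.complexConj L (dV i) = dV i)
  (dW : Fin 1 → L) (hdW : ∀ i, IsCMField.complexConj L (dW i) = dW i)
  (H : Matrix (Fin 2) (Fin 2) L) (t : L) (ht : t ≠ 0) (g : GL (Fin 2) L)
  (hg : formCongr ((IsCMField.complexConj L : L ≃ₐ[↥(maximalRealSubfield L)] L) : L →+* L) g (t • H) = Matrix.diagonal dV)
  (ιA : (UnitaryGroup.adelicGroupData (Fp L) L (IsCMField.complexConj L) 2 H).Adelic →*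
    UnitaryGroup.adelic (Fp L) L (IsCMField.complexConj L) 2 (Matrix.diagonal dV))
  (hιA : ∀ k, ((ιA k : ↥(UnitaryGroup.adelic (Fp L) L (IsCMField.complexConj L) 2 (Matrix.diagonal dV))) :
        GL (Fin 2) (AdeleRing (𝓞 L) L)) =
      (toAdeleGL L g)⁻¹ * UnitaryGroup.adelicVal (Fp L) L (IsCMField.complexConj L) 2 H k * toAdeleGL L g)
  (S : Finset (HeightOneSpectrum (𝓞 (Fp L)))) [DecidableEq (HeightOneSpectrum (𝓞 (Fp L)))]

/-- transport of the even members `tv(2i) = c_i · z^i` along a group isomorphism (kept OUTSIDE the main proof: generic and instant). [folklore] -/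
theorem symm_apply_tv_even {G G' : Type*} [Group G] [Group G'] (f : G ≃* G') (tv cv : ℕ → G') (z : G')
    (htv2 : ∀ i, tv (2 * i) = cv i * z ^ i) (i : ℕ) :
    f.symm (tv (2 * i)) = 1 * f.symm (cv i) * f.symm z ^ i := by
  rw [htv2 i, map_mul, map_pow, one_mul]

/-- transport of the odd members `tv(2i+1) = tv 1 · (c_i · z^i)` along a group isomorphism. [folklore] -/
theorem symm_apply_tv_odd {G G' : Type*} [Group G] [Group G'] (f : G ≃* G') (tv cv : ℕ → G') (z : G')
    (htv21 : ∀ i, tv (2 * i + 1) = tv 1 * (cv i * z ^ i)) (i : ℕ) :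
    f.symm (tv (2 * i + 1)) = f.symm (tv 1) * f.symm (cv i) * f.symm z ^ i := by
  rw [htv21 i, map_mul, map_mul, map_pow, mul_assoc]

omit [IsCMField L] [DecidableEq (HeightOneSpectrum (𝓞 (Fp L)))] in
/-- the sharp-exponent numerics at ANY finite place: `(√‖ϖ‖_w)^τ · q_w < 1` for `τ > 2` (`‖ϖ‖_w = q_w⁻¹`). [cite: Li1992, §3 Thm. 3.1] -/
theorem sqrt_norm_rpow_mul_card_lt_one [IsCMField L] (w : HeightOneSpectrum (𝓞 L)) {ϖ : w.adicCompletion L}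
    (hϖ : Valued.v ϖ = WithZero.exp (-1 : ℤ)) {τ : ℝ} (hτ : 2 * (2 : ℝ) - 2 < τ) :
    Real.sqrt ‖ϖ‖ ^ τ * (Nat.card 𝓀[w.adicCompletion L] : ℝ) < 1 := by
  have hτ0 : 0 < τ := by linarith
  have h := rpow_norm_uniformizer_mul_pow_lt_one L (N := 2) hϖ hτ0 hτ
  have h3 : ‖ϖ‖ ^ (((1 : ℕ) : ℝ) / 2) = Real.sqrt ‖ϖ‖ := by rw [Real.sqrt_eq_rpow]; norm_num
  rw [h3, show (2 : ℕ) - 1 = 1 from rfl, pow_one, natCard_valuativeResidueField_adicCompletion_eq L w] at h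
  rwa [IsDedekindDomain.HeightOneSpectrum.natCard_residueField_adicCompletion L w, ← HeightOneSpectrum.residueCard_eq_card_quotient]

set_option maxHeartbeats 400000 in -- as ★ `K2LiuInertCartanVolumes` ∕ ★ (F4a) (measured 2026-09-04): 200000 times out at `whnf` on the `localPi` transports; 400000 passes
include ht hg hιA in
/-- **THE RANK-ONE CARTAN DECAY DATUM AT AN ISOTROPIC NON-SPLIT PLACE — ANY RAMIFICATION, ANY RESIDUE CHARACTERISTIC**, in the exact shape of the closer's
`_hns` (★ `doublingHeightDecayLocalR2_of_nonsplitData`): `K₀ = κ_v⁻¹Ψ⁻¹(U(σ_w,J₀) ∩ GL₂(𝒪_w))`, `Ψ(κ_v(tv m)) = diag(ϖ^m, (σϖ^m)⁻¹)`, `Q = q_w`, `r = √‖ϖ‖_w`.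
[cite: GelbartPiatetskishapiroRallis1987, Part A §6] [cite: Li1992, §3 Thm. 3.1] [cite: Liu2011, §2C p. 863] [cite: BruhatTits1972, (4.4.3)] -/
theorem exists_rankOneDatum_isotropic (hdV0 : ∀ i, dV i ≠ 0) (hdW0 : ∀ i, dW i ≠ 0) (vS : S)
    [MeasurableSpace (UnitaryGroup.localPi L (IsCMField.complexConj L) 2 H vS.1)]
    [BorelSpace (UnitaryGroup.localPi L (IsCMField.complexConj L) 2 H vS.1)]
    [MeasurableSpace (UnitaryGroup.localPi L (IsCMField.complexConj L) 2 (Matrix.diagonal dV) vS.1)]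
    [BorelSpace (UnitaryGroup.localPi L (IsCMField.complexConj L) 2 (Matrix.diagonal dV) vS.1)]
    (ν : Measure (UnitaryGroup.localPi L (IsCMField.complexConj L) 2 H vS.1)) [ν.IsHaarMeasure]
    {Φ : HA L e dV hdV dW hdW → ℝ} (hΦc : Continuous Φ) (hΦpos : ∀ x, 0 < Φ x)
    (hΦ : ∀ p x : HA L e dV hdV dW hdW, IsSiegelDelta L e dV hdV dW hdW p →
      Φ (p * x) = modDelta L e dV hdV dW hdW p * Φ x)
    -- the place data: a place `w ∣ v` fixed by `c`, ANY uniformiser, ANY hyperbolic frame of the place form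
    (w : UnitaryGroup.PlacesOver L vS.1) (hw : IsCMField.complexConj L • w.1 = w.1)
    {ϖ : w.1.adicCompletion L} (hϖ : Valued.v ϖ = WithZero.exp (-1 : ℤ))
    (T : GL (Fin 2) (w.1.adicCompletion L))
    (hTJ : UnitaryGroup.placeForm (Matrix.diagonal dV) w.1 =
      formCongr (galAdicCompletionMap (L := L) (IsCMField.complexConj L) hw) T ((StdForm.antidiagonal 2).over (w.1.adicCompletion L)))
    {τ : ℝ} (hτ : 2 * (2 : ℝ) - 2 < τ) :
    ∃ (K₀ : Subgroup (UnitaryGroup.localPi L (IsCMField.complexConj L) 2 H vS.1))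
      (tv : ℕ → UnitaryGroup.localPi L (IsCMField.complexConj L) 2 H vS.1) (C₁ Q C₂ r : ℝ),
      IsOpen (K₀ : Set (UnitaryGroup.localPi L (IsCMField.complexConj L) 2 H vS.1)) ∧
      IsCompact (K₀ : Set (UnitaryGroup.localPi L (IsCMField.complexConj L) 2 H vS.1)) ∧
      IsCartanFamily K₀ tv ∧ 0 ≤ Q ∧ 0 ≤ C₂ ∧ 0 ≤ r ∧ r ^ τ * Q < 1 ∧
      (∀ m, (ν (DoubleCoset.doubleCoset (tv m) (K₀ : Set _) K₀)).toReal ≤ C₁ * Q ^ m) ∧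
      (∀ m, Φ (iotaLeft L e dV hdV dW hdW (ιA (placesEmbed L H S (1, Pi.mulSingle vS (tv m))))) ≤ C₂ * r ^ m) := by
  have hcc : IsCMField.complexConj L * IsCMField.complexConj L = 1 := AlgEquiv.ext fun x => IsCMField.complexConj_apply_apply L x
  set σ := galAdicCompletionMap (L := L) (IsCMField.complexConj L) hw with hσ
  have hσσ : ∀ x, σ (σ x) = x := Liu2021.galAdicCompletionMap_galAdicCompletionMap_self (Fp L) L (IsCMField.complexConj L) hcc hw
  have hvσ : ∀ x, Valued.v (σ x) = Valued.v x := fun x => valued_galAdicCompletionMap (L := L) (IsCMField.complexConj L) hw x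
  have hϖ0 : ϖ ≠ 0 := fun h0 => by rw [h0, map_zero] at hϖ; exact WithZero.coe_ne_zero hϖ.symm
  -- the local congruence `κ_v : U(H)(L⁺_v) ≃ₜ* U(diag dV)(L⁺_v)` (OPAQUE, with ★ p05's slice-point identity as its one property) and the transported Haar measure
  obtain ⟨κ, hκ⟩ : ∃ κ : UnitaryGroup.localPi L (IsCMField.complexConj L) 2 H vS.1 ≃ₜ* UnitaryGroup.localPi L (IsCMField.complexConj L) 2 (Matrix.diagonal dV) vS.1,
      ∀ u, iotaLeft L e dV hdV dW hdW (ιA (placesEmbed L H S (1, Pi.mulSingle vS u))) =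
        locToAdelic L e dV hdV dW hdW vS.1 (iotaLeftLocPi L e dV hdV dW hdW vS.1 (κ u)) :=
    ⟨localCongr L (IsCMField.complexConj L) g⁻¹ (inv_ne_zero ht) (formCongr_inv_inv_smul L H dV t ht g hg) vS.1,
      fun u => iotaLeft_iotaA_placesEmbed_mulSingle L e dV hdV dW hdW H t ht g hg ιA hιA S vS u⟩
  haveI : (ν.map κ).IsHaarMeasure := κ.isHaarMeasure_map ν
  -- ★ (F4a): the volume datum on `U(diag dV)(L⁺_v)` with its auxiliary ray and central unit
  obtain ⟨K, tv, cv, z, C₁, Q, hKo, hKc, hcart, hQ, -, hz, hcvw, htv2, htv21, hvol⟩ :=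
    exists_cartanVolumeDatum_anyPlace L dV vS.1 w hw hϖ T hTJ (ν.map κ)
  -- transport of the datum along `κ_v` (as in ★ `exists_rankOneDatum_inert`; only generic coercion lemmas touch `κ`)
  have hκc : Continuous (κ.toMulEquiv : UnitaryGroup.localPi L (IsCMField.complexConj L) 2 H vS.1 →
      UnitaryGroup.localPi L (IsCMField.complexConj L) 2 (Matrix.diagonal dV) vS.1) := by
    rw [cme_coe_toMulEquiv]; exact map_continuous κ
  have hκsc : Continuous (κ.toMulEquiv.symm : UnitaryGroup.localPi L (IsCMField.complexConj L) 2 (Matrix.diagonal dV) vS.1 →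
      UnitaryGroup.localPi L (IsCMField.complexConj L) 2 H vS.1) := by
    have h : (κ.toMulEquiv.symm : _ → _) = κ.symm := funext fun y => cme_toMulEquiv_symm_apply κ y
    rw [h]; exact map_continuous κ.symm
  let K₀ : Subgroup (UnitaryGroup.localPi L (IsCMField.complexConj L) 2 H vS.1) := K.comap κ.toMulEquiv.toMonoidHom
  have hKK : ∀ x, κ.toMulEquiv x ∈ K ↔ x ∈ K₀ := fun x => by
    rw [Subgroup.mem_comap, MulEquiv.coe_toMonoidHom]
  have hK₀set : (K₀ : Set (UnitaryGroup.localPi L (IsCMField.complexConj L) 2 H vS.1)) = κ.toMulEquiv ⁻¹' (K : Set _) :=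
    Set.ext fun x => (hKK x).symm.trans Set.mem_preimage.symm
  have hK₀o : IsOpen (K₀ : Set (UnitaryGroup.localPi L (IsCMField.complexConj L) 2 H vS.1)) := by
    rw [hK₀set]; exact hKo.preimage hκc
  have hK₀c : IsCompact (K₀ : Set (UnitaryGroup.localPi L (IsCMField.complexConj L) 2 H vS.1)) := by
    have himg : (K₀ : Set (UnitaryGroup.localPi L (IsCMField.complexConj L) 2 H vS.1)) = κ.toMulEquiv.symm '' (K : Set _) := by
      rw [hK₀set]
      ext x
      constructor
      · intro hx
        exact ⟨κ.toMulEquiv x, Set.mem_preimage.1 hx, κ.toMulEquiv.symm_apply_apply x⟩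
      · rintro ⟨y, hy, rfl⟩
        refine Set.mem_preimage.2 ?_
        rw [MulEquiv.apply_symm_apply]
        exact hy
    rw [himg]
    exact hKc.image hκsc
  have hcart' : IsCartanFamily K₀ (fun m => κ.toMulEquiv.symm (tv m)) := isCartanFamily_of_mulEquiv κ.toMulEquiv hKK hcart
  have hvol' : ∀ m, (ν (DoubleCoset.doubleCoset (κ.toMulEquiv.symm (tv m)) (K₀ : Set _) K₀)).toReal ≤ C₁ * Q ^ m := by
    intro m
    have hset : DoubleCoset.doubleCoset (κ.toMulEquiv.symm (tv m)) (K₀ : Set _) K₀ =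
        κ.toMulEquiv ⁻¹' DoubleCoset.doubleCoset (tv m) (K : Set _) K := by
      exact Set.ext fun x => (mem_doubleCoset_symm_iff κ.toMulEquiv hKK (tv m) x).trans Set.mem_preimage.symm
    have hmap : (ν.map κ) (DoubleCoset.doubleCoset (tv m) (K : Set _) K) = ν (κ.toMulEquiv ⁻¹' DoubleCoset.doubleCoset (tv m) (K : Set _) K) := by
      rw [← cme_coe_toMulEquiv, Measure.map_apply hκc.measurable (measurableSet_doubleCoset hKo (tv m))]
    rw [hset, ← hmap]
    exact hvol m
  -- the decay: ★ (F3) along the σ_w-fixed ray `c_i`, ★ (A1) quasi-bi-invariance for the twisted and odd members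
  obtain ⟨C, hC, hCdec⟩ := exists_decay_cartan_frame L e dV hdV dW hdW vS.1 w hw T hTJ hΦc hΦpos hΦ
  set π : w.1.adicCompletion L := ϖ * σ ϖ with hπ
  have hσπ : ∀ i : ℕ, σ (π ^ i) = π ^ i := fun i => by rw [map_pow, hπ, map_mul, hσσ, mul_comm]
  have hvπ1 : Valued.v π ≤ 1 := by
    rw [hπ, map_mul, hvσ, hϖ, ← WithZero.exp_add, ← WithZero.exp_zero, WithZero.exp_le_exp]; norm_num
  have hvπ : ∀ i : ℕ, Valued.v (π ^ i) ≤ 1 := fun i => by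
    rw [map_pow]; exact pow_le_one₀ zero_le hvπ1
  have hπ0 : ∀ i : ℕ, π ^ i ≠ 0 := fun i => pow_ne_zero i (mul_ne_zero hϖ0 (fun h0 => hϖ0 (by
    have := hvσ ϖ; rw [h0, map_zero] at this; exact (Valuation.zero_iff _).1 this.symm)))
  have hnormπ : ∀ i : ℕ, Real.sqrt ‖π ^ i‖ = Real.sqrt ‖ϖ‖ ^ (2 * i) := fun i => by
    rw [norm_pow, hπ, norm_mul, hσ, norm_galAdicCompletionMap, ← sq, ← pow_mul, Real.sqrt_eq_rpow, Real.sqrt_eq_rpow,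
      ← Real.rpow_natCast, ← Real.rpow_mul (norm_nonneg _), ← Real.rpow_natCast, ← Real.rpow_mul (norm_nonneg _)]
    congr 1; push_cast; ring
  have hdec_ray : ∀ i : ℕ, Φ (iotaLeft L e dV hdV dW hdW (ιA (placesEmbed L H S (1, Pi.mulSingle vS (κ.toMulEquiv.symm (cv i)))))) ≤
      C * Real.sqrt ‖ϖ‖ ^ (2 * i) := by
    intro i
    have h := hCdec (π ^ i) (hσπ i) (hvπ i) (hπ0 i) (cv i) (hcvw i)
    rw [hnormπ i] at h
    have hy : κ (κ.toMulEquiv.symm (cv i)) = cv i := by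
      rw [cme_toMulEquiv_symm_apply]; exact κ.apply_symm_apply (cv i)
    -- (the two rewrites are done by `congrArg` on explicit motives: no higher-order matching inside the adelic terms)
    calc Φ (iotaLeft L e dV hdV dW hdW (ιA (placesEmbed L H S (1, Pi.mulSingle vS (κ.toMulEquiv.symm (cv i))))))
        = Φ (locToAdelic L e dV hdV dW hdW vS.1 (iotaLeftLocPi L e dV hdV dW hdW vS.1 (κ (κ.toMulEquiv.symm (cv i))))) := congrArg Φ (hκ _)
      _ = Φ (locToAdelic L e dV hdV dW hdW vS.1 (iotaLeftLocPi L e dV hdV dW hdW vS.1 (cv i))) :=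
          congrArg (fun u => Φ (locToAdelic L e dV hdV dW hdW vS.1 (iotaLeftLocPi L e dV hdV dW hdW vS.1 u))) hy
      _ ≤ C * Real.sqrt ‖ϖ‖ ^ (2 * i) := h
  -- quasi-bi-invariance of the slice under `{1, κ⁻¹ tv 1}` (left) and `K₀` (right)
  obtain ⟨ΨA, -, hΨA⟩ := exists_continuousMulEquiv_eq_iotaA L H dV t ht g hg ιA hιA
  have hιc : Continuous ιA := by
    have h : (ιA : _ → _) = ΨA := funext fun x => (hΨA x).symm
    rw [h]; exact ΨA.continuous
  have hC₁c : IsCompact ({1, κ.toMulEquiv.symm (tv 1)} : Set (UnitaryGroup.localPi L (IsCMField.complexConj L) 2 H vS.1)) :=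
    (Set.toFinite _).isCompact
  obtain ⟨c, hc, hq⟩ := exists_placeSlice_quasiBiInvariant L e dV hdV dW hdW H ιA S hdV0 hdW0 hιc vS hΦc hΦpos hΦ hC₁c hK₀c
  have hzK : ∀ i : ℕ, κ.toMulEquiv.symm z ^ i ∈ K₀ :=
    fun i => Subgroup.pow_mem _ ((hKK _).1 (by rw [MulEquiv.apply_symm_apply]; exact hz)) i
  have h1C : (1 : UnitaryGroup.localPi L (IsCMField.complexConj L) 2 H vS.1) ∈ ({1, κ.toMulEquiv.symm (tv 1)} : Set _) := Set.mem_insert _ _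
  have htC : κ.toMulEquiv.symm (tv 1) ∈ ({1, κ.toMulEquiv.symm (tv 1)} : Set (UnitaryGroup.localPi L (IsCMField.complexConj L) 2 H vS.1)) :=
    Set.mem_insert_of_mem _ (Set.mem_singleton _)
  -- `r = √‖ϖ‖`, `0 < r ≤ 1`
  set r : ℝ := Real.sqrt ‖ϖ‖ with hr
  have hr0 : 0 < r := Real.sqrt_pos.2 (norm_pos_iff.2 hϖ0)
  have hr1 : r ≤ 1 := by
    rw [hr, Real.sqrt_le_one, norm_eq_inv_residueCard_of_valued_eq hϖ]
    exact inv_le_one_of_one_le₀ (by exact_mod_cast w.1.one_lt_residueCard.le)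
  -- (slice values are compared through `congrArg` on the explicit motive `key`: no higher-order matching inside the adelic terms)
  have key : ∀ {x y : UnitaryGroup.localPi L (IsCMField.complexConj L) 2 H vS.1}, x = y →
      Φ (iotaLeft L e dV hdV dW hdW (ιA (placesEmbed L H S (1, Pi.mulSingle vS x)))) =
        Φ (iotaLeft L e dV hdV dW hdW (ιA (placesEmbed L H S (1, Pi.mulSingle vS y)))) :=
    fun h => congrArg (fun u => Φ (iotaLeft L e dV hdV dW hdW (ιA (placesEmbed L H S (1, Pi.mulSingle vS u))))) h
  have hdec' : ∀ m, Φ (iotaLeft L e dV hdV dW hdW (ιA (placesEmbed L H S (1, Pi.mulSingle vS (κ.toMulEquiv.symm (tv m)))))) ≤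
      (c * C / r) * r ^ m := by
    intro m
    obtain ⟨i, rfl | rfl⟩ := Nat.even_or_odd' m
    · -- `tv(2i) = 1 · c_i · z^i`
      have hfac : κ.toMulEquiv.symm (tv (2 * i)) = 1 * κ.toMulEquiv.symm (cv i) * κ.toMulEquiv.symm z ^ i :=
        symm_apply_tv_even κ.toMulEquiv tv cv z htv2 i
      refine (key hfac).trans_le (((hq _ 1 h1C _ (hzK i)).1).trans ?_)
      calc c * Φ (iotaLeft L e dV hdV dW hdW (ιA (placesEmbed L H S (1, Pi.mulSingle vS (κ.toMulEquiv.symm (cv i))))))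
          ≤ c * (C * r ^ (2 * i)) := mul_le_mul_of_nonneg_left (hdec_ray i) hc.le
        _ = (c * C) * r ^ (2 * i) := by ring
        _ ≤ (c * C / r) * r ^ (2 * i) :=
            mul_le_mul_of_nonneg_right (le_div_self (mul_nonneg hc.le hC.le) hr0 hr1) (pow_nonneg hr0.le _)
    · -- `tv(2i+1) = tv 1 · c_i · z^i`
      -- (the algebra is done OUTSIDE this proof, `symm_apply_tv_odd`: inside, `rw` on these terms is pathologically slow)
      have hfac : κ.toMulEquiv.symm (tv (2 * i + 1)) = κ.toMulEquiv.symm (tv 1) * κ.toMulEquiv.symm (cv i) * κ.toMulEquiv.symm z ^ i :=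
        symm_apply_tv_odd κ.toMulEquiv tv cv z htv21 i
      refine (key hfac).trans_le (((hq _ _ htC _ (hzK i)).1).trans ?_)
      calc c * Φ (iotaLeft L e dV hdV dW hdW (ιA (placesEmbed L H S (1, Pi.mulSingle vS (κ.toMulEquiv.symm (cv i))))))
          ≤ c * (C * r ^ (2 * i)) := mul_le_mul_of_nonneg_left (hdec_ray i) hc.le
        _ = (c * C / r) * r ^ (2 * i + 1) := by rw [pow_succ]; field_simp
  refine ⟨K₀, fun m => κ.toMulEquiv.symm (tv m), C₁, Q, c * C / r, r, hK₀o, hK₀c, hcart', ?_, by positivity, hr0.le, ?_, hvol', hdec'⟩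
  · rw [hQ]; positivity
  · rw [hQ]; exact sqrt_norm_rpow_mul_card_lt_one L w.1 hϖ hτ

include ht hg hιA in
/-- **THE FINITE SLICE OF #32dR AT AN ISOTROPIC NON-SPLIT PLACE `v ∈ S` (any ramification, any residue characteristic)**: for `2·2 − 2 < τ`,
`u ↦ Φ(ι(ιA placesEmbed_S(1, u at v), 1))^τ` is integrable on `U(H)(L⁺_v)` — `_hfin v` of ★ (R) ∕ ★ (α) at such a place ((NS-i) fed with
`exists_rankOneDatum_isotropic`). [cite: GelbartPiatetskishapiroRallis1987, Part A §6] [cite: Li1992, §3 Thm. 3.1] [cite: Liu2011, §2C p. 863] -/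
theorem integrable_placeSlice_isotropic (hdV0 : ∀ i, dV i ≠ 0) (hdW0 : ∀ i, dW i ≠ 0) (vS : S)
    [MeasurableSpace (UnitaryGroup.localPi L (IsCMField.complexConj L) 2 H vS.1)]
    [BorelSpace (UnitaryGroup.localPi L (IsCMField.complexConj L) 2 H vS.1)]
    [MeasurableSpace (UnitaryGroup.localPi L (IsCMField.complexConj L) 2 (Matrix.diagonal dV) vS.1)]
    [BorelSpace (UnitaryGroup.localPi L (IsCMField.complexConj L) 2 (Matrix.diagonal dV) vS.1)]
    (ν : Measure (UnitaryGroup.localPi L (IsCMField.complexConj L) 2 H vS.1)) [ν.IsHaarMeasure]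
    {Φ : HA L e dV hdV dW hdW → ℝ} (hΦc : Continuous Φ) (hΦpos : ∀ x, 0 < Φ x)
    (hΦ : ∀ p x : HA L e dV hdV dW hdW, IsSiegelDelta L e dV hdV dW hdW p →
      Φ (p * x) = modDelta L e dV hdV dW hdW p * Φ x)
    (w : UnitaryGroup.PlacesOver L vS.1) (hw : IsCMField.complexConj L • w.1 = w.1)
    {ϖ : w.1.adicCompletion L} (hϖ : Valued.v ϖ = WithZero.exp (-1 : ℤ))
    (T : GL (Fin 2) (w.1.adicCompletion L))
    (hTJ : UnitaryGroup.placeForm (Matrix.diagonal dV) w.1 =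
      formCongr (galAdicCompletionMap (L := L) (IsCMField.complexConj L) hw) T ((StdForm.antidiagonal 2).over (w.1.adicCompletion L)))
    {τ : ℝ} (hτ : 2 * (2 : ℝ) - 2 < τ) :
    Integrable (fun u => Φ (iotaLeft L e dV hdV dW hdW (ιA (placesEmbed L H S (1, Pi.mulSingle vS u)))) ^ τ) ν := by
  obtain ⟨K₀, tv, C₁, Q, C₂, r, hK₀o, hK₀c, htv, hQ, hC₂, hr, hrQ, hvol, hdec⟩ :=
    exists_rankOneDatum_isotropic L e dV hdV dW hdW H t ht g hg ιA hιA S hdV0 hdW0 vS ν hΦc hΦpos hΦ w hw hϖ T hTJ hτ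
  exact integrable_placeSlice_of_rankOneDecay L e dV hdV dW hdW H t ht g hg ιA hιA S hdV0 hdW0 vS ν hΦc hΦpos hΦ hK₀o hK₀c htv hQ hvol
    (by linarith) hC₂ hr hrQ hdec

end Summit.HodgeConjecture.HodgeConjecture.Cruxes.HLiu418.K2LiuNonsplitSliceIsotropic

end
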